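import Literature.NumberTheory.Automorphic.UnitaryGroupSymplecticCarriers
import Literature.NumberTheory.Weil1964.AdelicMetaplecticSumStripping
import Literature.NumberTheory.Weil1964.AdelicMetaplecticReindex
import Literature.NumberTheory.Weil1964.AdelicThetaWitness
import Literature.NumberTheory.GelbartRogawski1991.DoubledUnitaryGlobalSplittingData
import HarnessLib

-- buildfix G11b-3 #2 (ops-buildfix-1 g13, 2026-08-21): elaborate sequentially so the trailing `attribute [implicit_reducible]`
-- block (reducibilityCoreExt is keyed to the async environment branch) is in force at `.olean` export.
set_option Elab.async false

/-!
# Undoubling: from the doubled Weil representation to a compatible splitting over `U(𝕍)(𝔸)`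

[GelbartRogawski1991, §3.1 Prop. 3.1.1] by doubling [Kudla1994, §2], last step, for the objects of
`DoubledUnitaryGlobalSplittingData`: restrict a continuous `sD : H(𝔸) →* Mp(𝕎^𝔻)ᶜᵒⁿᵗ` over `ι^𝔻` to
`U(𝕍)(𝔸) × 1 ⊂ H(𝔸)` (`inlG`).  `ι^𝔻(g, 1) = ι(g) ⊕ 1_{𝕎⁻}` (read on `Fin n ⊕ Fin n` with Gram matrix `Tg ⊕ (−Tg)`
after the index change `undoubleIdx`), whose implementers are `M₁ ⊠ 1` by the tree's sum-stripping theorem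
`exists_strip_of_fst_eq_spSum_one` (`AdelicMetaplecticSumStripping`): `s(g)` := the unique
`(ι g, M₁) ∈ Mp(𝕎)ᶜᵒⁿᵗ` with `ω(sD(g ⊕ 1))(Φ₁ ⊠ Φ₂) = M₁ Φ₁ ⊠ Φ₂` (`undouble`, `undouble_unique`); a homomorphism by
uniqueness (`undoubleHom`), continuous by matrix coefficients at `Φ₁ ⊠ Φ₂⁰` (`continuous_undoubleHom`), and
`r_F`-valued on `G₁(L⁺)` when `sD` is `r_F^𝔻`-valued on `G₁(L⁺) × 1`, by Θ-rigidity
(`Θ^𝔻(Φ₁ ⊠ Φ₂) = Θ(Φ₁) Θ(Φ₂)`, `undouble_mem_range_ratSection`).  End theorem `S4_undouble`: the datum of record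
`cmSplittingDatum …` has `CompatibleSplitting` as soon as such an `sD` exists.
-/

set_option autoImplicit false

noncomputable section

open scoped Classical
open scoped Matrix Kronecker TensorProduct
open NumberField IsDedekindDomain
open Literature.RepresentationTheory.HeisenbergGroup
open Literature.NumberTheory.Automorphic
open Literature.NumberTheory.Weil1964
open Literature.RepresentationTheory.HarrisKudlaSweet1996
open Literature.NumberTheory.GaloisRepresentations

namespace Literature.NumberTheory.GelbartRogawski1991.GRConstruction

open UnitaryDualPair

variable (L : Type) [Field L] [NumberField L] [IsCMField L]

variable {N M n : ℕ} (e : Fin N × Fin M ≃ Fin n)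
  (dV : Fin N → L) (hdV : ∀ i, IsCMField.complexConj L (dV i) = dV i) (hdV0 : ∀ i, dV i ≠ 0)
  (dW : Fin M → L) (hdW : ∀ i, IsCMField.complexConj L (dW i) = dW i) (hdW0 : ∀ i, dW i ≠ 0)

section S4

local notation "𝔸⁺" => AdeleRing (𝓞 (Fp L)) (Fp L)

/-- the datum's adelic Gram matrix `Tg = T ⊗ 1 ∈ M_n(𝔸_{L⁺})`.
[cite: Kudla1994, §2 (doubled space, Siegel parabolic), Thm. 3.1] -/
abbrev gramA : Matrix (Fin n) (Fin n) 𝔸⁺ := adelicGram (Fp L) e (realDiagonal L dV hdV) (realDiagonal L dW hdW)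

include hdV0 hdW0 in
/-- `det Tg` is a unit (the proof term of the datum).
[cite: Kudla1994, §2 (doubled space, Siegel parabolic), Thm. 3.1] -/
theorem isUnit_det_gramA : IsUnit (gramA L e dV hdV dW hdW).det :=
  isUnit_det_adelicGram (Fp L) e (isUnit_det_realDiagonal L dV hdV hdV0) (isUnit_det_realDiagonal L dW hdW hdW0)

include hdV0 hdW0 in
/-- `Tg` is invertible. [cite: Kudla1994, §2 (doubled space, Siegel parabolic), Thm. 3.1] -/
theorem isUnit_gramA : IsUnit (gramA L e dV hdV dW hdW) :=
  (Matrix.isUnit_iff_isUnit_det _).2 (isUnit_det_gramA L e dV hdV hdV0 dW hdW hdW0)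

/-- `Tg = gramR ⊗ 1` (the datum's `adelicGram` is the base change of the rational Gram matrix).
[cite: Kudla1994, §2 (doubled space, Siegel parabolic), Thm. 3.1] -/
theorem gramA_eq_map : gramA L e dV hdV dW hdW = (gramR L e dV hdV dW hdW).map (algebraMap (Fp L) 𝔸⁺) :=
  adelicGram_eq_map (Fp L) e _ _

/-- the Gram matrix `Tg ⊕ (−Tg)` of the doubled space on the index `Fin n ⊕ Fin n`.
[cite: Kudla1994, §2 (doubled space, Siegel parabolic), Thm. 3.1] -/
abbrev gramS : Matrix (Fin n ⊕ Fin n) (Fin n ⊕ Fin n) 𝔸⁺ :=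
  Matrix.fromBlocks (gramA L e dV hdV dW hdW) 0 0 (-gramA L e dV hdV dW hdW)

/-- **the doubled Gram matrix read on `Fin n ⊕ Fin n` is `Tg ⊕ (−Tg)`** (relabelling identity with `C = 1`).
[cite: Kudla1994, §2 (doubled space, Siegel parabolic), Thm. 3.1] -/
theorem gramS_mul_one :
    gramS L e dV hdV dW hdW * ((1 : GL (Fin n ⊕ Fin n) 𝔸⁺) : Matrix (Fin n ⊕ Fin n) (Fin n ⊕ Fin n) 𝔸⁺) =
      Matrix.reindex (e₂ (n := n)).symm (e₂ (n := n)).symm (gramDA L e dV hdV dW hdW) := by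
  rw [Units.val_one, Matrix.mul_one, gramS, gramDA, gramD, UnitaryGroup.reindex_map, Matrix.reindex_apply,
    Matrix.reindex_apply, Matrix.submatrix_submatrix, Equiv.symm_symm, Equiv.symm_comp_self, Matrix.submatrix_id_id,
    Matrix.fromBlocks_map, Matrix.map_zero _ (map_zero _), gramA_eq_map, Matrix.map_neg _ (fun a => map_neg _ a)]

/-- **the undoubling index change** `Mp(𝕎^𝔻)ᶜᵒⁿᵗ →* Mp_ψ((𝕎 ⊕ 𝕎⁻)_𝔸)ᶜᵒⁿᵗ` on `Fin n ⊕ Fin n` with Gram matrix `Tg ⊕ (−Tg)`: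
reindexing along `e₂⁻¹` followed by the relabelling with `C = 1`.
[cite: Kudla1994, §2 (doubled space, Siegel parabolic), Thm. 3.1] -/
def undoubleIdx : MpD L e dV hdV dW hdW →* adelicMpCont (Fp L) (Fin n ⊕ Fin n) (gramS L e dV hdV dW hdW) :=
  (adelicMpContRelabel (Fp L) (Fin n ⊕ Fin n) 1 (gramS_mul_one L e dV hdV dW hdW)).toMonoidHom.comp
    (adelicMpContReindex (Fp L) (e₂ (n := n)).symm (gramDA L e dV hdV dW hdW)).toMonoidHom

/-- `undoubleIdx` is continuous. [cite: Kudla1994, §2 (doubled space, Siegel parabolic), Thm. 3.1] -/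
theorem continuous_undoubleIdx : Continuous (undoubleIdx L e dV hdV dW hdW) :=
  (continuous_adelicMpContRelabel (Fp L) (Fin n ⊕ Fin n) 1 (gramS_mul_one L e dV hdV dW hdW)).comp
    (continuous_adelicMpContReindex (Fp L) (e₂ (n := n)).symm (gramDA L e dV hdV dW hdW))

/-- `undoubleIdx` preserves Θ-fixing (same operator up to reindexing, `Θ ∘ R_e = Θ`).
[cite: Kudla1994, §2 (doubled space, Siegel parabolic), Thm. 3.1] -/
theorem undoubleIdx_mem_adelicMpTheta_iff (q : MpD L e dV hdV dW hdW) :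
    ((undoubleIdx L e dV hdV dW hdW q).1 : adelicMp (Fp L) (Fin n ⊕ Fin n) (gramS L e dV hdV dW hdW)) ∈
        adelicMpTheta (Fp L) (Fin n ⊕ Fin n) (gramS L e dV hdV dW hdW) ↔
      (q.1 : adelicMp (Fp L) (Fin (n + n)) (gramDA L e dV hdV dW hdW)) ∈
        adelicMpTheta (Fp L) (Fin (n + n)) (gramDA L e dV hdV dW hdW) :=
  (coe_adelicMpContRelabel_mem_adelicMpTheta_iff (Fp L) (Fin n ⊕ Fin n) 1 (gramS_mul_one L e dV hdV dW hdW) _).trans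
    (coe_adelicMpContReindex_mem_adelicMpTheta_iff (Fp L) (e₂ (n := n)).symm (gramDA L e dV hdV dW hdW) q)

omit [IsCMField L] in
/-- vector-level bookkeeping: `Λ₁ ∘ R_{e₂⁻¹} ∘ X ∘ R_{e₂⁻¹}⁻¹ ∘ Λ₁⁻¹` in coordinates.
[cite: Kudla1994, §2 (doubled space, Siegel parabolic), Thm. 3.1] -/
theorem relabel_reindex_apply
    (X : ((Fin (n + n) → 𝔸⁺) × (Fin (n + n) → 𝔸⁺)) ≃ₗ[𝔸⁺] ((Fin (n + n) → 𝔸⁺) × (Fin (n + n) → 𝔸⁺)))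
    (w : (Fin n ⊕ Fin n → 𝔸⁺) × (Fin n ⊕ Fin n → 𝔸⁺)) :
    relabelVec (Fp L) (Fin n ⊕ Fin n) 1 (UnitaryGroup.reindexW 𝔸⁺ (e₂ (n := n)).symm
      (X ((UnitaryGroup.reindexW 𝔸⁺ (e₂ (n := n)).symm).symm ((relabelVec (Fp L) (Fin n ⊕ Fin n) 1).symm w)))) =
      ((X (w.1 ∘ ⇑(e₂ (n := n)).symm, w.2 ∘ ⇑(e₂ (n := n)).symm)).1 ∘ ⇑(e₂ (n := n)),
        (X (w.1 ∘ ⇑(e₂ (n := n)).symm, w.2 ∘ ⇑(e₂ (n := n)).symm)).2 ∘ ⇑(e₂ (n := n))) := by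
  simp only [relabelVec_symm_apply, relabelVec_apply, inv_one, Units.val_one, Matrix.one_mulVec,
    UnitaryGroup.reindexW_symm_apply, UnitaryGroup.reindexW_apply, Equiv.symm_symm]

/-- **`π ∘ undoubleIdx` in coordinates**: `π(undoubleIdx q) w = e₂^* (π(q) ((e₂⁻¹)^* w))`.
[cite: Kudla1994, §2 (doubled space, Siegel parabolic), Thm. 3.1] -/
theorem proj_undoubleIdx_apply (q : MpD L e dV hdV dW hdW) (w : (Fin n ⊕ Fin n → 𝔸⁺) × (Fin n ⊕ Fin n → 𝔸⁺)) :
    (adelicMpCont.proj (Fp L) (Fin n ⊕ Fin n) (gramS L e dV hdV dW hdW) (undoubleIdx L e dV hdV dW hdW q)).1 w =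
      (((projD L e dV hdV dW hdW q).1 (w.1 ∘ ⇑(e₂ (n := n)).symm, w.2 ∘ ⇑(e₂ (n := n)).symm)).1 ∘ ⇑(e₂ (n := n)),
        ((projD L e dV hdV dW hdW q).1 (w.1 ∘ ⇑(e₂ (n := n)).symm, w.2 ∘ ⇑(e₂ (n := n)).symm)).2 ∘ ⇑(e₂ (n := n))) :=
  relabel_reindex_apply L (projD L e dV hdV dW hdW q).1 w

/-- the GL-matrix of `g ⊕ 1 ∈ H(𝔸)`: `reindex e₂ (diag (reindex e g, 1))`.
[cite: Kudla1994, §2 (doubled space, Siegel parabolic), Thm. 3.1] -/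
theorem coe_inlG (g : UnitaryGroup.adelicPair (Fp L) L (IsCMField.complexConj L) N M (Matrix.diagonal dV) (Matrix.diagonal dW)) :
    ((inlG L e dV hdV dW hdW g : HA L e dV hdV dW hdW) : GL (Fin (n + n)) (AdeleRing (𝓞 L) L)) =
      UnitaryGroup.reindexGL (e₂ (n := n))
        (UnitaryGroup.blockDiagGL (UnitaryGroup.reindexGL e (g : GL (Fin N × Fin M) (AdeleRing (𝓞 L) L)), 1)) :=
  rfl

/-- the quadratic coordinates of record (`𝔸_L = 𝔸_{L⁺} ⊕ 𝔸_{L⁺} δ`).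
[cite: Kudla1994, §2 (doubled space, Siegel parabolic), Thm. 3.1] -/
abbrev qc := UnitaryGroup.isQuadraticCoordinates_adele L (IsCMField.complexConj L) (complexConj_imagUnit L)
  (imagUnit_ne_zero L) (imagUnit_mul_self L)

/-- `ι^𝔻(h)` as a linear automorphism is the restriction of scalars of the matrix of `h`.
[cite: Kudla1994, §2 (doubled space, Siegel parabolic), Thm. 3.1] -/
theorem coe_toSpD (h : HA L e dV hdV dW hdW) :
    (toSpD L e dV hdV dW hdW h).1 = (qc L).resAut (Fin (n + n)) (h : GL (Fin (n + n)) (AdeleRing (𝓞 L) L)) := rfl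

/-- `ι(g)` (the datum's `toSp`) as a linear automorphism: `e_* (Res g)`.
[cite: Kudla1994, §2 (doubled space, Siegel parabolic), Thm. 3.1] -/
theorem coe_toSp (g : UnitaryGroup.adelicPair (Fp L) L (IsCMField.complexConj L) N M (Matrix.diagonal dV) (Matrix.diagonal dW)) :
    ((D L e dV hdV hdV0 dW hdW hdW0).toSp g).1 =
      (UnitaryGroup.reindexW 𝔸⁺ e).symm ≪≫ₗ (qc L).resAut (Fin N × Fin M) (g : GL (Fin N × Fin M) (AdeleRing (𝓞 L) L)) ≪≫ₗ
        UnitaryGroup.reindexW 𝔸⁺ e := rfl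

/-- **`ι^𝔻(g ⊕ 1)` as a linear automorphism**: `(e₂)_* (ι(g) ⊕ 1)`.
[cite: Kudla1994, §2 (doubled space, Siegel parabolic), Thm. 3.1] -/
theorem coe_toSpD_inlG (g : UnitaryGroup.adelicPair (Fp L) L (IsCMField.complexConj L) N M (Matrix.diagonal dV) (Matrix.diagonal dW)) :
    (toSpD L e dV hdV dW hdW (inlG L e dV hdV dW hdW g)).1 =
      (UnitaryGroup.reindexW 𝔸⁺ (e₂ (n := n))).symm ≪≫ₗ
        UnitaryGroup.spSumEquiv ((D L e dV hdV hdV0 dW hdW hdW0).toSp g).1 (LinearEquiv.refl _ _) ≪≫ₗ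
          UnitaryGroup.reindexW 𝔸⁺ (e₂ (n := n)) := by
  have h1 : (toSpD L e dV hdV dW hdW (inlG L e dV hdV dW hdW g)).1 =
      (qc L).resAut (Fin (n + n)) (UnitaryGroup.reindexGL (e₂ (n := n))
        (UnitaryGroup.blockDiagGL (UnitaryGroup.reindexGL e (g : GL (Fin N × Fin M) (AdeleRing (𝓞 L) L)), 1))) := rfl
  have h2 := (qc L).resAut_reindexGL (R := 𝔸⁺) (e₂ (n := n))
    (UnitaryGroup.blockDiagGL (UnitaryGroup.reindexGL e (g : GL (Fin N × Fin M) (AdeleRing (𝓞 L) L)), 1))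
  have h3 := (qc L).resAut_blockDiagGL (R := 𝔸⁺)
    (UnitaryGroup.reindexGL e (g : GL (Fin N × Fin M) (AdeleRing (𝓞 L) L)), (1 : GL (Fin n) (AdeleRing (𝓞 L) L)))
  have h4 : (qc L).resAut (Fin n) (UnitaryGroup.reindexGL e (g : GL (Fin N × Fin M) (AdeleRing (𝓞 L) L))) =
      ((D L e dV hdV hdV0 dW hdW hdW0).toSp g).1 :=
    (qc L).resAut_reindexGL (R := 𝔸⁺) e (g : GL (Fin N × Fin M) (AdeleRing (𝓞 L) L))
  have h5 : (qc L).resAut (Fin n) (1 : GL (Fin n) (AdeleRing (𝓞 L) L)) = LinearEquiv.refl 𝔸⁺ _ :=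
    map_one ((qc L).resAut (R := 𝔸⁺) (Fin n))
  exact h1.trans (h2.trans (congrArg
    (fun Y => (UnitaryGroup.reindexW 𝔸⁺ (e₂ (n := n))).symm ≪≫ₗ Y ≪≫ₗ UnitaryGroup.reindexW 𝔸⁺ (e₂ (n := n)))
    (h3.trans (congrArg₂ UnitaryGroup.spSumEquiv h4 h5))))

/-- `g ↦ g ⊕ 1` is continuous. [cite: Kudla1994, §2 (doubled space, Siegel parabolic), Thm. 3.1] -/
theorem continuous_inlG : Continuous (inlG L e dV hdV dW hdW) := by
  refine continuous_induced_rng.2 ?_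
  change Continuous fun g => ((inlG L e dV hdV dW hdW g : HA L e dV hdV dW hdW) : GL (Fin (n + n)) (AdeleRing (𝓞 L) L))
  simp only [coe_inlG]
  exact (UnitaryGroup.continuous_reindexGL _).comp (UnitaryGroup.continuous_blockDiagGL.comp
    (((UnitaryGroup.continuous_reindexGL _).comp continuous_subtype_val).prodMk continuous_const))

variable {sD : HA L e dV hdV dW hdW →* MpD L e dV hdV dW hdW}

variable (sD) in
/-- the doubled splitting read on `g ⊕ 1`, on the index `Fin n ⊕ Fin n`: `u(g) = undoubleIdx (sD (g ⊕ 1))`.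
[cite: Kudla1994, §2 (doubled space, Siegel parabolic), Thm. 3.1] -/
def uD : UnitaryGroup.adelicPair (Fp L) L (IsCMField.complexConj L) N M (Matrix.diagonal dV) (Matrix.diagonal dW) →*
    adelicMpCont (Fp L) (Fin n ⊕ Fin n) (gramS L e dV hdV dW hdW) :=
  (undoubleIdx L e dV hdV dW hdW).comp (sD.comp (inlG L e dV hdV dW hdW))

/-- `u` is continuous if `sD` is. [cite: Kudla1994, §2 (doubled space, Siegel parabolic), Thm. 3.1] -/
theorem continuous_uD (hc : Continuous sD) : Continuous (uD L e dV hdV dW hdW sD) :=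
  (continuous_undoubleIdx L e dV hdV dW hdW).comp (hc.comp (continuous_inlG L e dV hdV dW hdW))

omit [IsCMField L] in
/-- vector-level bookkeeping: `(R_{e₂}⁻¹ S R_{e₂})` read back on `Fin n ⊕ Fin n` is `S`.
[cite: Kudla1994, §2 (doubled space, Siegel parabolic), Thm. 3.1] -/
theorem reindexW_conj_apply
    (S : ((Fin n ⊕ Fin n → 𝔸⁺) × (Fin n ⊕ Fin n → 𝔸⁺)) ≃ₗ[𝔸⁺] ((Fin n ⊕ Fin n → 𝔸⁺) × (Fin n ⊕ Fin n → 𝔸⁺)))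
    (w : (Fin n ⊕ Fin n → 𝔸⁺) × (Fin n ⊕ Fin n → 𝔸⁺)) :
    S w =
      ((((UnitaryGroup.reindexW 𝔸⁺ (e₂ (n := n))).symm ≪≫ₗ S ≪≫ₗ UnitaryGroup.reindexW 𝔸⁺ (e₂ (n := n)))
          (w.1 ∘ ⇑(e₂ (n := n)).symm, w.2 ∘ ⇑(e₂ (n := n)).symm)).1 ∘ ⇑(e₂ (n := n)),
        (((UnitaryGroup.reindexW 𝔸⁺ (e₂ (n := n))).symm ≪≫ₗ S ≪≫ₗ UnitaryGroup.reindexW 𝔸⁺ (e₂ (n := n)))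
          (w.1 ∘ ⇑(e₂ (n := n)).symm, w.2 ∘ ⇑(e₂ (n := n)).symm)).2 ∘ ⇑(e₂ (n := n))) := by
  simp only [LinearEquiv.trans_apply, UnitaryGroup.reindexW_symm_apply, UnitaryGroup.reindexW_apply, Function.comp_assoc,
    Equiv.symm_comp_self, Function.comp_id]

/-- **`π(u(g)) = ι(g) ⊕ 1`** (over `ι^𝔻`: `hproj`).
[cite: Kudla1994, §2 (doubled space, Siegel parabolic), Thm. 3.1] -/
theorem proj_uD (hproj : ∀ h, projD L e dV hdV dW hdW (sD h) = toSpD L e dV hdV dW hdW h)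
    (g : UnitaryGroup.adelicPair (Fp L) L (IsCMField.complexConj L) N M (Matrix.diagonal dV) (Matrix.diagonal dW)) :
    adelicMpCont.proj (Fp L) (Fin n ⊕ Fin n) (gramS L e dV hdV dW hdW) (uD L e dV hdV dW hdW sD g) =
      UnitaryGroup.spSum (gramA L e dV hdV dW hdW) (-gramA L e dV hdV dW hdW) ((D L e dV hdV hdV0 dW hdW hdW0).toSp g, 1) := by
  apply Subtype.ext
  refine LinearEquiv.ext fun w => ?_
  have h1 : (adelicMpCont.proj (Fp L) (Fin n ⊕ Fin n) (gramS L e dV hdV dW hdW) (uD L e dV hdV dW hdW sD g)).1 w = _ :=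
    proj_undoubleIdx_apply L e dV hdV dW hdW (sD (inlG L e dV hdV dW hdW g)) w
  have h2 := congrArg (fun P : symplecticGroup (polar (adelicForm (Fp L) (Fin (n + n)) (gramDA L e dV hdV dW hdW))) =>
      ((P.1 (w.1 ∘ ⇑(e₂ (n := n)).symm, w.2 ∘ ⇑(e₂ (n := n)).symm)).1 ∘ ⇑(e₂ (n := n)),
        (P.1 (w.1 ∘ ⇑(e₂ (n := n)).symm, w.2 ∘ ⇑(e₂ (n := n)).symm)).2 ∘ ⇑(e₂ (n := n)))) (hproj (inlG L e dV hdV dW hdW g))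
  have h3 := congrArg (fun Y : ((Fin (n + n) → 𝔸⁺) × (Fin (n + n) → 𝔸⁺)) ≃ₗ[𝔸⁺] ((Fin (n + n) → 𝔸⁺) × (Fin (n + n) → 𝔸⁺)) =>
      ((Y (w.1 ∘ ⇑(e₂ (n := n)).symm, w.2 ∘ ⇑(e₂ (n := n)).symm)).1 ∘ ⇑(e₂ (n := n)),
        (Y (w.1 ∘ ⇑(e₂ (n := n)).symm, w.2 ∘ ⇑(e₂ (n := n)).symm)).2 ∘ ⇑(e₂ (n := n))))
    (coe_toSpD_inlG L e dV hdV hdV0 dW hdW hdW0 g)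
  have h4 := (reindexW_conj_apply L (UnitaryGroup.spSumEquiv ((D L e dV hdV hdV0 dW hdW hdW0).toSp g).1 (LinearEquiv.refl _ _)) w).symm
  have h5 := congrArg (fun Y : ((Fin n ⊕ Fin n → 𝔸⁺) × (Fin n ⊕ Fin n → 𝔸⁺)) ≃ₗ[𝔸⁺] ((Fin n ⊕ Fin n → 𝔸⁺) × (Fin n ⊕ Fin n → 𝔸⁺)) =>
      Y w) (UnitaryGroup.coe_spSum (T₁ := gramA L e dV hdV dW hdW) (T₂ := -gramA L e dV hdV dW hdW)
        ((D L e dV hdV hdV0 dW hdW hdW0).toSp g, 1))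
  exact h1.trans (h2.trans (h3.trans (h4.trans h5.symm)))

variable (sD) in
/-- **existence of the undoubled pair** (the sum-stripping theorem at `u(g)`).
[cite: Kudla1994, §2 (doubled space, Siegel parabolic), Thm. 3.1] -/
theorem exists_undouble (hproj : ∀ h, projD L e dV hdV dW hdW (sD h) = toSpD L e dV hdV dW hdW h)
    (g : UnitaryGroup.adelicPair (Fp L) L (IsCMField.complexConj L) N M (Matrix.diagonal dV) (Matrix.diagonal dW)) :
    ∃ p₁ : adelicMp (Fp L) (Fin n) (gramA L e dV hdV dW hdW), p₁ ∈ adelicMpCont (Fp L) (Fin n) (gramA L e dV hdV dW hdW) ∧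
      p₁.1.1 = (D L e dV hdV hdV0 dW hdW hdW0).toSp g ∧
      ∀ (Φ₁ : piSchwartzBruhat (Fp L) (Fin n)) (Φ₂ : piSchwartzBruhat (Fp L) (Fin n)),
        (uD L e dV hdV dW hdW sD g).1.1.2 (tensorToSum (Fp L) (Fin n) (Fin n) Φ₁ Φ₂) =
          tensorToSum (Fp L) (Fin n) (Fin n) (p₁.1.2 Φ₁) Φ₂ :=
  exists_strip_of_fst_eq_spSum_one (isUnit_gramA L e dV hdV hdV0 dW hdW hdW0) (isUnit_gramA L e dV hdV hdV0 dW hdW hdW0).neg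
    _ (uD L e dV hdV dW hdW sD g).2 ((D L e dV hdV hdV0 dW hdW hdW0).toSp g) (proj_uD L e dV hdV hdV0 dW hdW hdW0 hproj g)

/-- **the undoubled splitting** `s(g) ∈ Mp(𝕎)ᶜᵒⁿᵗ` (a choice, pinned by `proj_undouble` ∕ `omega_uD_tensorToSum` ∕
`undouble_unique`). [cite: Kudla1994, §2 (doubled space, Siegel parabolic), Thm. 3.1] -/
def undouble (hproj : ∀ h, projD L e dV hdV dW hdW (sD h) = toSpD L e dV hdV dW hdW h)
    (g : UnitaryGroup.adelicPair (Fp L) L (IsCMField.complexConj L) N M (Matrix.diagonal dV) (Matrix.diagonal dW)) :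
    adelicMpCont (Fp L) (Fin n) (gramA L e dV hdV dW hdW) :=
  ⟨Classical.choose (exists_undouble L e dV hdV hdV0 dW hdW hdW0 sD hproj g),
    (Classical.choose_spec (exists_undouble L e dV hdV hdV0 dW hdW hdW0 sD hproj g)).1⟩

/-- `π(s(g)) = ι(g)`. [cite: Kudla1994, §2 (doubled space, Siegel parabolic), Thm. 3.1] -/
theorem proj_undouble (hproj : ∀ h, projD L e dV hdV dW hdW (sD h) = toSpD L e dV hdV dW hdW h)
    (g : UnitaryGroup.adelicPair (Fp L) L (IsCMField.complexConj L) N M (Matrix.diagonal dV) (Matrix.diagonal dW)) :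
    adelicMpCont.proj (Fp L) (Fin n) (gramA L e dV hdV dW hdW) (undouble L e dV hdV hdV0 dW hdW hdW0 hproj g) =
      (D L e dV hdV hdV0 dW hdW hdW0).toSp g :=
  (Classical.choose_spec (exists_undouble L e dV hdV hdV0 dW hdW hdW0 sD hproj g)).2.1

/-- **the product formula** `ω(u(g))(Φ₁ ⊠ Φ₂) = ω(s(g))Φ₁ ⊠ Φ₂`.
[cite: Kudla1994, §2 (doubled space, Siegel parabolic), Thm. 3.1] -/
theorem omega_uD_tensorToSum (hproj : ∀ h, projD L e dV hdV dW hdW (sD h) = toSpD L e dV hdV dW hdW h)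
    (g : UnitaryGroup.adelicPair (Fp L) L (IsCMField.complexConj L) N M (Matrix.diagonal dV) (Matrix.diagonal dW))
    (Φ₁ Φ₂ : piSchwartzBruhat (Fp L) (Fin n)) :
    adelicMpCont.omega (Fp L) (Fin n ⊕ Fin n) (gramS L e dV hdV dW hdW) (uD L e dV hdV dW hdW sD g)
        (tensorToSum (Fp L) (Fin n) (Fin n) Φ₁ Φ₂) =
      tensorToSum (Fp L) (Fin n) (Fin n)
        (adelicMpCont.omega (Fp L) (Fin n) (gramA L e dV hdV dW hdW) (undouble L e dV hdV hdV0 dW hdW hdW0 hproj g) Φ₁) Φ₂ :=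
  (Classical.choose_spec (exists_undouble L e dV hdV hdV0 dW hdW hdW0 sD hproj g)).2.2 Φ₁ Φ₂

/-- the adelic Θ-witness as a test vector with value `1` at `0` and `Θ ≠ 0`.
[cite: Kudla1994, §2 (doubled space, Siegel parabolic), Thm. 3.1] -/
def testVec : piSchwartzBruhat (Fp L) (Fin n) := ⟨thetaWitness (Fp L) (Fin n), thetaWitness_mem (Fp L) (Fin n)⟩

omit [IsCMField L] in
/-- `testVec 0 = 1`. [cite: Kudla1994, §2 (doubled space, Siegel parabolic), Thm. 3.1] -/
theorem testVec_zero : (testVec L (n := n) : (Fin n → 𝔸⁺) → ℂ) 0 = 1 := thetaWitness_zero (Fp L) (Fin n)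

omit [IsCMField L] in
/-- `testVec ≠ 0`. [cite: Kudla1994, §2 (doubled space, Siegel parabolic), Thm. 3.1] -/
theorem testVec_ne_zero : testVec L (n := n) ≠ 0 := fun h => by
  have h1 := congrArg (fun Φ : piSchwartzBruhat (Fp L) (Fin n) => (Φ : (Fin n → 𝔸⁺) → ℂ) 0) h
  simp only [testVec_zero, ZeroMemClass.coe_zero, Pi.zero_apply] at h1
  exact one_ne_zero h1

omit [IsCMField L] in
/-- `Θ(testVec) ≠ 0`. [cite: Kudla1994, §2 (doubled space, Siegel parabolic), Thm. 3.1] -/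
theorem thetaDistLM_testVec_ne_zero : thetaDistLM (Fp L) (Fin n) (testVec L) ≠ 0 :=
  (thetaDistLM_apply (testVec L (n := n))).trans_ne (thetaDist_thetaWitness_ne_zero (Fp L) (Fin n))

/-- **uniqueness of the undoubled pair**: an element of `Mp(𝕎)ᶜᵒⁿᵗ` over `ι(g)` satisfying the product formula IS `s(g)`.
[cite: Kudla1994, §2 (doubled space, Siegel parabolic), Thm. 3.1] -/
theorem undouble_unique (hproj : ∀ h, projD L e dV hdV dW hdW (sD h) = toSpD L e dV hdV dW hdW h)
    (g : UnitaryGroup.adelicPair (Fp L) L (IsCMField.complexConj L) N M (Matrix.diagonal dV) (Matrix.diagonal dW))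
    (p : adelicMpCont (Fp L) (Fin n) (gramA L e dV hdV dW hdW))
    (hp : adelicMpCont.proj (Fp L) (Fin n) (gramA L e dV hdV dW hdW) p = (D L e dV hdV hdV0 dW hdW hdW0).toSp g)
    (hprod : ∀ Φ₁ Φ₂ : piSchwartzBruhat (Fp L) (Fin n),
      adelicMpCont.omega (Fp L) (Fin n ⊕ Fin n) (gramS L e dV hdV dW hdW) (uD L e dV hdV dW hdW sD g)
          (tensorToSum (Fp L) (Fin n) (Fin n) Φ₁ Φ₂) =
        tensorToSum (Fp L) (Fin n) (Fin n) (adelicMpCont.omega (Fp L) (Fin n) (gramA L e dV hdV dW hdW) p Φ₁) Φ₂) :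
    p = undouble L e dV hdV hdV0 dW hdW hdW0 hproj g := by
  apply Subtype.ext
  apply Subtype.ext
  refine Prod.ext (hp.trans (proj_undouble L e dV hdV hdV0 dW hdW hdW0 hproj g).symm) (LinearEquiv.toLinearMap_injective ?_)
  exact strip_unique (testVec_ne_zero L) fun Φ₁ =>
    (hprod Φ₁ (testVec L)).symm.trans (omega_uD_tensorToSum L e dV hdV hdV0 dW hdW hdW0 hproj g Φ₁ (testVec L))

/-- **`s` is a homomorphism** (uniqueness of the undoubled pair).
[cite: Kudla1994, §2 (doubled space, Siegel parabolic), Thm. 3.1] -/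
theorem undouble_mul (hproj : ∀ h, projD L e dV hdV dW hdW (sD h) = toSpD L e dV hdV dW hdW h)
    (g g' : UnitaryGroup.adelicPair (Fp L) L (IsCMField.complexConj L) N M (Matrix.diagonal dV) (Matrix.diagonal dW)) :
    undouble L e dV hdV hdV0 dW hdW hdW0 hproj (g * g') =
      undouble L e dV hdV hdV0 dW hdW hdW0 hproj g * undouble L e dV hdV hdV0 dW hdW hdW0 hproj g' := by
  symm
  refine undouble_unique L e dV hdV hdV0 dW hdW hdW0 hproj (g * g') _ ?_ fun Φ₁ Φ₂ => ?_
  · exact (map_mul (adelicMpCont.proj (Fp L) (Fin n) (gramA L e dV hdV dW hdW)) _ _).trans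
      ((congrArg₂ (· * ·) (proj_undouble L e dV hdV hdV0 dW hdW hdW0 hproj g)
        (proj_undouble L e dV hdV hdV0 dW hdW hdW0 hproj g')).trans (map_mul (D L e dV hdV hdV0 dW hdW hdW0).toSp g g').symm)
  · have e1 : adelicMpCont.omega (Fp L) (Fin n ⊕ Fin n) (gramS L e dV hdV dW hdW) (uD L e dV hdV dW hdW sD (g * g'))
          (tensorToSum (Fp L) (Fin n) (Fin n) Φ₁ Φ₂) =
        adelicMpCont.omega (Fp L) (Fin n ⊕ Fin n) (gramS L e dV hdV dW hdW) (uD L e dV hdV dW hdW sD g)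
          (adelicMpCont.omega (Fp L) (Fin n ⊕ Fin n) (gramS L e dV hdV dW hdW) (uD L e dV hdV dW hdW sD g')
            (tensorToSum (Fp L) (Fin n) (Fin n) Φ₁ Φ₂)) :=
      congrArg (fun T : Module.End ℂ (piSchwartzBruhat (Fp L) (Fin n ⊕ Fin n)) => T (tensorToSum (Fp L) (Fin n) (Fin n) Φ₁ Φ₂))
        ((congrArg (adelicMpCont.omega (Fp L) (Fin n ⊕ Fin n) (gramS L e dV hdV dW hdW)) (map_mul (uD L e dV hdV dW hdW sD) g g')).trans
          (map_mul (adelicMpCont.omega (Fp L) (Fin n ⊕ Fin n) (gramS L e dV hdV dW hdW)) _ _))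
    have e2 := congrArg (adelicMpCont.omega (Fp L) (Fin n ⊕ Fin n) (gramS L e dV hdV dW hdW) (uD L e dV hdV dW hdW sD g))
      (omega_uD_tensorToSum L e dV hdV hdV0 dW hdW hdW0 hproj g' Φ₁ Φ₂)
    have e3 := omega_uD_tensorToSum L e dV hdV hdV0 dW hdW hdW0 hproj g
      (adelicMpCont.omega (Fp L) (Fin n) (gramA L e dV hdV dW hdW) (undouble L e dV hdV hdV0 dW hdW hdW0 hproj g') Φ₁) Φ₂
    have e4 : tensorToSum (Fp L) (Fin n) (Fin n)
          (adelicMpCont.omega (Fp L) (Fin n) (gramA L e dV hdV dW hdW) (undouble L e dV hdV hdV0 dW hdW hdW0 hproj g)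
            (adelicMpCont.omega (Fp L) (Fin n) (gramA L e dV hdV dW hdW) (undouble L e dV hdV hdV0 dW hdW hdW0 hproj g') Φ₁))
          Φ₂ =
        tensorToSum (Fp L) (Fin n) (Fin n)
          (adelicMpCont.omega (Fp L) (Fin n) (gramA L e dV hdV dW hdW)
            (undouble L e dV hdV hdV0 dW hdW hdW0 hproj g * undouble L e dV hdV hdV0 dW hdW hdW0 hproj g') Φ₁) Φ₂ :=
      congrArg (fun T : Module.End ℂ (piSchwartzBruhat (Fp L) (Fin n)) => tensorToSum (Fp L) (Fin n) (Fin n) (T Φ₁) Φ₂)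
        (map_mul (adelicMpCont.omega (Fp L) (Fin n) (gramA L e dV hdV dW hdW)) _ _).symm
    exact e1.trans (e2.trans (e3.trans e4))

variable (sD) in
/-- **the undoubled splitting as a homomorphism** `s : G₁(𝔸) →* Mp(𝕎)ᶜᵒⁿᵗ`.
[cite: Kudla1994, §2 (doubled space, Siegel parabolic), Thm. 3.1] -/
def undoubleHom (hproj : ∀ h, projD L e dV hdV dW hdW (sD h) = toSpD L e dV hdV dW hdW h) :
    UnitaryGroup.adelicPair (Fp L) L (IsCMField.complexConj L) N M (Matrix.diagonal dV) (Matrix.diagonal dW) →*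
      adelicMpCont (Fp L) (Fin n) (gramA L e dV hdV dW hdW) :=
  MonoidHom.mk' (undouble L e dV hdV hdV0 dW hdW hdW0 hproj) (undouble_mul L e dV hdV hdV0 dW hdW hdW0 hproj)

/-- unfolding. [cite: Kudla1994, §2 (doubled space, Siegel parabolic), Thm. 3.1] -/
@[simp] theorem undoubleHom_apply (hproj : ∀ h, projD L e dV hdV dW hdW (sD h) = toSpD L e dV hdV dW hdW h)
    (g : UnitaryGroup.adelicPair (Fp L) L (IsCMField.complexConj L) N M (Matrix.diagonal dV) (Matrix.diagonal dW)) :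
    undoubleHom L e dV hdV hdV0 dW hdW hdW0 sD hproj g = undouble L e dV hdV hdV0 dW hdW hdW0 hproj g := rfl

omit [IsCMField L] in
/-- vector-level bookkeeping: the `inl`-part of `(S ⊕ T)(w ⊕ 0)` is `S w`.
[cite: Kudla1994, §2 (doubled space, Siegel parabolic), Thm. 3.1] -/
theorem spSumEquiv_apply_inl (S : ((Fin n → 𝔸⁺) × (Fin n → 𝔸⁺)) ≃ₗ[𝔸⁺] ((Fin n → 𝔸⁺) × (Fin n → 𝔸⁺)))
    (T : ((Fin n → 𝔸⁺) × (Fin n → 𝔸⁺)) ≃ₗ[𝔸⁺] ((Fin n → 𝔸⁺) × (Fin n → 𝔸⁺))) (w : (Fin n → 𝔸⁺) × (Fin n → 𝔸⁺)) :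
    (((UnitaryGroup.spSumEquiv S T (Sum.elim w.1 0, Sum.elim w.2 0)).1 ∘ Sum.inl,
      (UnitaryGroup.spSumEquiv S T (Sum.elim w.1 0, Sum.elim w.2 0)).2 ∘ Sum.inl)) = S w := by
  simp only [UnitaryGroup.spSumEquiv_apply, Sum.elim_comp_inl]

/-- the `π`-orbit maps of `s` are the `inl`-parts of those of `u` at `(w, 0)`.
[cite: Kudla1994, §2 (doubled space, Siegel parabolic), Thm. 3.1] -/
theorem proj_undouble_apply (hproj : ∀ h, projD L e dV hdV dW hdW (sD h) = toSpD L e dV hdV dW hdW h)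
    (g : UnitaryGroup.adelicPair (Fp L) L (IsCMField.complexConj L) N M (Matrix.diagonal dV) (Matrix.diagonal dW))
    (w : (Fin n → 𝔸⁺) × (Fin n → 𝔸⁺)) :
    (adelicMpCont.proj (Fp L) (Fin n) (gramA L e dV hdV dW hdW) (undouble L e dV hdV hdV0 dW hdW hdW0 hproj g)).1 w =
      (((adelicMpCont.proj (Fp L) (Fin n ⊕ Fin n) (gramS L e dV hdV dW hdW) (uD L e dV hdV dW hdW sD g)).1
          (Sum.elim w.1 0, Sum.elim w.2 0)).1 ∘ Sum.inl,
        ((adelicMpCont.proj (Fp L) (Fin n ⊕ Fin n) (gramS L e dV hdV dW hdW) (uD L e dV hdV dW hdW sD g)).1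
          (Sum.elim w.1 0, Sum.elim w.2 0)).2 ∘ Sum.inl) := by
  have h1 := congrArg (fun P : symplecticGroup (polar (adelicForm (Fp L) (Fin n) (gramA L e dV hdV dW hdW))) => P.1 w)
    (proj_undouble L e dV hdV hdV0 dW hdW hdW0 hproj g)
  have h2 := congrArg (fun P : symplecticGroup (polar (adelicForm (Fp L) (Fin n ⊕ Fin n) (gramS L e dV hdV dW hdW))) =>
      ((P.1 (Sum.elim w.1 0, Sum.elim w.2 0)).1 ∘ Sum.inl, (P.1 (Sum.elim w.1 0, Sum.elim w.2 0)).2 ∘ Sum.inl))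
    (proj_uD L e dV hdV hdV0 dW hdW hdW0 hproj g)
  have h3 := congrArg (fun Y : ((Fin n ⊕ Fin n → 𝔸⁺) × (Fin n ⊕ Fin n → 𝔸⁺)) ≃ₗ[𝔸⁺] ((Fin n ⊕ Fin n → 𝔸⁺) × (Fin n ⊕ Fin n → 𝔸⁺)) =>
      ((Y (Sum.elim w.1 0, Sum.elim w.2 0)).1 ∘ Sum.inl, (Y (Sum.elim w.1 0, Sum.elim w.2 0)).2 ∘ Sum.inl))
    (UnitaryGroup.coe_spSum (T₁ := gramA L e dV hdV dW hdW) (T₂ := -gramA L e dV hdV dW hdW)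
      ((D L e dV hdV hdV0 dW hdW hdW0).toSp g, 1))
  have h4 := spSumEquiv_apply_inl L ((D L e dV hdV hdV0 dW hdW hdW0).toSp g).1
    (1 : symplecticGroup (polar (adelicForm (Fp L) (Fin n) (-gramA L e dV hdV dW hdW)))).1 w
  exact h1.trans ((h2.trans (h3.trans h4)).symm)

/-- the matrix coefficients of `s` are matrix coefficients of `u` at `Φ₁ ⊠ Φ₂⁰`, `Φ₂⁰(0) = 1`.
[cite: Kudla1994, §2 (doubled space, Siegel parabolic), Thm. 3.1] -/
theorem omega_undouble_apply (hproj : ∀ h, projD L e dV hdV dW hdW (sD h) = toSpD L e dV hdV dW hdW h)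
    (g : UnitaryGroup.adelicPair (Fp L) L (IsCMField.complexConj L) N M (Matrix.diagonal dV) (Matrix.diagonal dW))
    (Φ₁ : piSchwartzBruhat (Fp L) (Fin n)) (x : Fin n → 𝔸⁺) :
    ((adelicMpCont.omega (Fp L) (Fin n) (gramA L e dV hdV dW hdW) (undouble L e dV hdV hdV0 dW hdW hdW0 hproj g) Φ₁ :
        piSchwartzBruhat (Fp L) (Fin n)) : (Fin n → 𝔸⁺) → ℂ) x =
      ((adelicMpCont.omega (Fp L) (Fin n ⊕ Fin n) (gramS L e dV hdV dW hdW) (uD L e dV hdV dW hdW sD g)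
          (tensorToSum (Fp L) (Fin n) (Fin n) Φ₁ (testVec L)) : piSchwartzBruhat (Fp L) (Fin n ⊕ Fin n)) :
        (Fin n ⊕ Fin n → 𝔸⁺) → ℂ) (Sum.elim x 0) := by
  have h1 := congrArg (fun Ψ : piSchwartzBruhat (Fp L) (Fin n ⊕ Fin n) => (Ψ : (Fin n ⊕ Fin n → 𝔸⁺) → ℂ) (Sum.elim x 0))
    (omega_uD_tensorToSum L e dV hdV hdV0 dW hdW hdW0 hproj g Φ₁ (testVec L))
  simp only [coe_tensorToSum, boxTensor_apply, Sum.elim_inl, Sum.elim_inr, Pi.zero_apply] at h1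
  have h2 : ((adelicMpCont.omega (Fp L) (Fin n) (gramA L e dV hdV dW hdW) (undouble L e dV hdV hdV0 dW hdW hdW0 hproj g) Φ₁ :
        piSchwartzBruhat (Fp L) (Fin n)) : (Fin n → 𝔸⁺) → ℂ) x * (testVec L (n := n) : (Fin n → 𝔸⁺) → ℂ) 0 =
      ((adelicMpCont.omega (Fp L) (Fin n) (gramA L e dV hdV dW hdW) (undouble L e dV hdV hdV0 dW hdW hdW0 hproj g) Φ₁ :
        piSchwartzBruhat (Fp L) (Fin n)) : (Fin n → 𝔸⁺) → ℂ) x :=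
    (congrArg (HMul.hMul _) (testVec_zero L)).trans (mul_one _)
  exact (h1.trans h2).symm

/-- **continuity of `s`**: the `π`-orbit maps and the matrix coefficients of `s(g)` are read off those of `u(g)`.
[cite: Kudla1994, §2 (doubled space, Siegel parabolic), Thm. 3.1] -/
theorem continuous_undouble (hc : Continuous sD) (hproj : ∀ h, projD L e dV hdV dW hdW (sD h) = toSpD L e dV hdV dW hdW h) :
    Continuous (undouble L e dV hdV hdV0 dW hdW hdW0 hproj) := by
  rw [continuous_into_adelicMpCont_iff, continuous_into_adelicMp_iff]
  have hu := continuous_uD L e dV hdV dW hdW hc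
  refine ⟨fun w => ?_, fun Φ₁ x => ?_⟩
  · have hW := (adelicMpCont.continuous_proj_apply (F := Fp L) (ι := Fin n ⊕ Fin n) (T := gramS L e dV hdV dW hdW)
      (Sum.elim w.1 0, Sum.elim w.2 0)).comp hu
    have key : (fun g => (MpPsi.proj (adelicSchrodinger (Fp L) (Fin n) (gramA L e dV hdV dW hdW))
        (undouble L e dV hdV hdV0 dW hdW hdW0 hproj g).1).1 w) =
      fun g => (((adelicMpCont.proj (Fp L) (Fin n ⊕ Fin n) (gramS L e dV hdV dW hdW) (uD L e dV hdV dW hdW sD g)).1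
          (Sum.elim w.1 0, Sum.elim w.2 0)).1 ∘ Sum.inl,
        ((adelicMpCont.proj (Fp L) (Fin n ⊕ Fin n) (gramS L e dV hdV dW hdW) (uD L e dV hdV dW hdW sD g)).1
          (Sum.elim w.1 0, Sum.elim w.2 0)).2 ∘ Sum.inl) :=
      funext fun g => proj_undouble_apply L e dV hdV hdV0 dW hdW hdW0 hproj g w
    rw [key]
    exact (continuous_pi fun i => (continuous_apply (Sum.inl i)).comp (continuous_fst.comp hW)).prodMk
      (continuous_pi fun i => (continuous_apply (Sum.inl i)).comp (continuous_snd.comp hW))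
  · have hx := (adelicMpCont.continuous_omega_apply (F := Fp L) (ι := Fin n ⊕ Fin n) (T := gramS L e dV hdV dW hdW)
      (tensorToSum (Fp L) (Fin n) (Fin n) Φ₁ (testVec L)) (Sum.elim x 0)).comp hu
    have key : (fun g => ((omegaPsi (adelicSchrodinger (Fp L) (Fin n) (gramA L e dV hdV dW hdW))
        (undouble L e dV hdV hdV0 dW hdW hdW0 hproj g).1 Φ₁ : piSchwartzBruhat (Fp L) (Fin n)) : (Fin n → 𝔸⁺) → ℂ) x) =
      fun g => ((adelicMpCont.omega (Fp L) (Fin n ⊕ Fin n) (gramS L e dV hdV dW hdW) (uD L e dV hdV dW hdW sD g)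
          (tensorToSum (Fp L) (Fin n) (Fin n) Φ₁ (testVec L)) : piSchwartzBruhat (Fp L) (Fin n ⊕ Fin n)) :
            (Fin n ⊕ Fin n → 𝔸⁺) → ℂ) (Sum.elim x 0) :=
      funext fun g => omega_undouble_apply L e dV hdV hdV0 dW hdW hdW0 hproj g Φ₁ x
    rw [key]
    exact hx

/-- **continuity of the homomorphism `s`.** [cite: Kudla1994, §2 (doubled space, Siegel parabolic), Thm. 3.1] -/
theorem continuous_undoubleHom (hc : Continuous sD)
    (hproj : ∀ h, projD L e dV hdV dW hdW (sD h) = toSpD L e dV hdV dW hdW h) :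
    Continuous (undoubleHom L e dV hdV hdV0 dW hdW hdW0 sD hproj) :=
  continuous_undouble L e dV hdV hdV0 dW hdW hdW0 hc hproj

/-- **Θ-rigidity transfer**: if `u(γ)` fixes `Θ^𝔻` then `s(γ)` fixes `Θ` (`Θ^𝔻(Φ₁ ⊠ Φ₂) = Θ(Φ₁)Θ(Φ₂)`, `Θ(Φ₂⁰) ≠ 0`).
[cite: Kudla1994, §2 (doubled space, Siegel parabolic), Thm. 3.1] -/
theorem undouble_mem_adelicMpTheta (hproj : ∀ h, projD L e dV hdV dW hdW (sD h) = toSpD L e dV hdV dW hdW h)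
    (γ : UnitaryGroup.adelicPair (Fp L) L (IsCMField.complexConj L) N M (Matrix.diagonal dV) (Matrix.diagonal dW))
    (hΘ : ((uD L e dV hdV dW hdW sD γ).1 : adelicMp (Fp L) (Fin n ⊕ Fin n) (gramS L e dV hdV dW hdW)) ∈
      adelicMpTheta (Fp L) (Fin n ⊕ Fin n) (gramS L e dV hdV dW hdW)) :
    ((undouble L e dV hdV hdV0 dW hdW hdW0 hproj γ).1 : adelicMp (Fp L) (Fin n) (gramA L e dV hdV dW hdW)) ∈
      adelicMpTheta (Fp L) (Fin n) (gramA L e dV hdV dW hdW) := by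
  rw [mem_adelicMpTheta_iff] at hΘ ⊢
  intro Φ₁
  have h1 : thetaDistLM (Fp L) (Fin n ⊕ Fin n)
      ((MpPsi.toOp (adelicSchrodinger (Fp L) (Fin n ⊕ Fin n) (gramS L e dV hdV dW hdW)) (uD L e dV hdV dW hdW sD γ).1)
        (tensorToSum (Fp L) (Fin n) (Fin n) Φ₁ (testVec L))) =
      thetaDistLM (Fp L) (Fin n ⊕ Fin n) (tensorToSum (Fp L) (Fin n) (Fin n) Φ₁ (testVec L)) :=
    hΘ (tensorToSum (Fp L) (Fin n) (Fin n) Φ₁ (testVec L))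
  have h2 : (MpPsi.toOp (adelicSchrodinger (Fp L) (Fin n ⊕ Fin n) (gramS L e dV hdV dW hdW)) (uD L e dV hdV dW hdW sD γ).1)
      (tensorToSum (Fp L) (Fin n) (Fin n) Φ₁ (testVec L)) =
      tensorToSum (Fp L) (Fin n) (Fin n)
        ((MpPsi.toOp (adelicSchrodinger (Fp L) (Fin n) (gramA L e dV hdV dW hdW))
          (undouble L e dV hdV hdV0 dW hdW hdW0 hproj γ).1) Φ₁) (testVec L) :=
    omega_uD_tensorToSum L e dV hdV hdV0 dW hdW hdW0 hproj γ Φ₁ (testVec L)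
  have h3 := (((congrArg (thetaDistLM (Fp L) (Fin n ⊕ Fin n)) h2).trans (thetaDistLM_tensorToSum _ _)).symm.trans
    (h1.trans (thetaDistLM_tensorToSum _ _)))
  exact mul_right_cancel₀ (thetaDistLM_testVec_ne_zero L) h3

/-- **rationality of `s`**: on `G₁(L⁺)`, `s(γ) = r_F(ι γ)` — `u(γ) = undoubleIdx (r_F^𝔻(·))` fixes `Θ^𝔻`, hence `s(γ)` fixes `Θ`,
and a Θ-fixing pair over the rational point `ι γ ∈ Sp_F(𝕎)` IS Weil's `r_F`.
[cite: Kudla1994, §2 (doubled space, Siegel parabolic), Thm. 3.1] -/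
theorem undouble_mem_range_ratSection (hproj : ∀ h, projD L e dV hdV dW hdW (sD h) = toSpD L e dV hdV dW hdW h)
    (hrat : ∀ γ ∈ (UnitaryGroup.rationalPairToAdelic (Fp L) L (IsCMField.complexConj L) N M
        (Matrix.diagonal dV) (Matrix.diagonal dW)).range,
      sD (inlG L e dV hdV dW hdW γ) ∈ (rFD L e dV hdV hdV0 dW hdW hdW0).range)
    (γ : UnitaryGroup.adelicPair (Fp L) L (IsCMField.complexConj L) N M (Matrix.diagonal dV) (Matrix.diagonal dW))
    (hγ : γ ∈ (UnitaryGroup.rationalPairToAdelic (Fp L) L (IsCMField.complexConj L) N M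
        (Matrix.diagonal dV) (Matrix.diagonal dW)).range) :
    undouble L e dV hdV hdV0 dW hdW hdW0 hproj γ ∈
      (ratSection (Fp L) (gramA L e dV hdV dW hdW) (isUnit_det_gramA L e dV hdV hdV0 dW hdW hdW0)).range := by
  -- `u(γ)` fixes `Θ^𝔻`
  have hr := hrat γ hγ
  obtain ⟨A', hA'⟩ := hr
  have hΘD : ((sD (inlG L e dV hdV dW hdW γ)).1 : adelicMp (Fp L) (Fin (n + n)) (gramDA L e dV hdV dW hdW)) ∈
      adelicMpTheta (Fp L) (Fin (n + n)) (gramDA L e dV hdV dW hdW) :=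
    hA' ▸ coe_ratThetaLiftCont_mem_adelicMpTheta (Fp L) (gramDA L e dV hdV dW hdW) _ A'
  have hΘu : ((uD L e dV hdV dW hdW sD γ).1 : adelicMp (Fp L) (Fin n ⊕ Fin n) (gramS L e dV hdV dW hdW)) ∈
      adelicMpTheta (Fp L) (Fin n ⊕ Fin n) (gramS L e dV hdV dW hdW) :=
    (undoubleIdx_mem_adelicMpTheta_iff L e dV hdV dW hdW _).2 hΘD
  have hΘs := undouble_mem_adelicMpTheta L e dV hdV hdV0 dW hdW hdW0 hproj γ hΘu
  -- `ι γ` is rational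
  have hγ' := (D L e dV hdV hdV0 dW hdW hdW0).toSp_mem_spRat γ hγ
  obtain ⟨A, hA⟩ := hγ'
  have hp : MpPsi.proj (adelicSchrodinger (Fp L) (Fin n) (gramA L e dV hdV dW hdW))
      (undouble L e dV hdV hdV0 dW hdW hdW0 hproj γ).1 =
      ratSpι (Fp L) (Fin n) (gramA L e dV hdV dW hdW) (isUnit_det_gramA L e dV hdV hdV0 dW hdW hdW0) A :=
    (proj_undouble L e dV hdV hdV0 dW hdW hdW0 hproj γ).trans (hA.symm.trans
      (DFunLike.congr_fun (ratSpι_fin (Fp L) (gramA L e dV hdV dW hdW) (isUnit_det_gramA L e dV hdV hdV0 dW hdW hdW0)) A).symm)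
  have hs := coe_ratThetaLiftContι_eq (Fp L) (Fin n) (gramA L e dV hdV dW hdW)
    (isUnit_det_gramA L e dV hdV hdV0 dW hdW hdW0) hΘs hp
  have hs' : ((ratThetaLiftCont (Fp L) (gramA L e dV hdV dW hdW) (isUnit_det_gramA L e dV hdV hdV0 dW hdW hdW0) A :
      adelicMpCont (Fp L) (Fin n) (gramA L e dV hdV dW hdW)) : adelicMp (Fp L) (Fin n) (gramA L e dV hdV dW hdW)) =
      (undouble L e dV hdV hdV0 dW hdW hdW0 hproj γ).1 :=
    (congrArg Subtype.val (ratThetaLiftContι_fin (Fp L) (gramA L e dV hdV dW hdW)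
      (isUnit_det_gramA L e dV hdV hdV0 dW hdW hdW0) A)).symm.trans hs
  exact ⟨⟨ratSp (Fp L) (gramA L e dV hdV dW hdW) (isUnit_det_gramA L e dV hdV hdV0 dW hdW hdW0) A, A, rfl⟩,
    (ratSection_apply (Fp L) _ _ A).trans (Subtype.ext hs')⟩

/-- **S4 (UNDOUBLING)**: a continuous homomorphism over `ι^𝔻` on the doubled group which is `r_F^𝔻`-valued on
`G₁(L⁺) × 1` undoubles to a COMPATIBLE SPLITTING of the datum of record.
[cite: Kudla1994, §2 (doubled space, Siegel parabolic), Thm. 3.1] -/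
theorem S4_undouble {sD : HA L e dV hdV dW hdW →* MpD L e dV hdV dW hdW} (hc : Continuous sD)
    (hproj : ∀ h, projD L e dV hdV dW hdW (sD h) = toSpD L e dV hdV dW hdW h)
    (hrat : ∀ γ ∈ (UnitaryGroup.rationalPairToAdelic (Fp L) L (IsCMField.complexConj L) N M
        (Matrix.diagonal dV) (Matrix.diagonal dW)).range,
      sD (inlG L e dV hdV dW hdW γ) ∈ (rFD L e dV hdV hdV0 dW hdW hdW0).range) :
    (D L e dV hdV hdV0 dW hdW hdW0).CompatibleSplitting := by
  refine ⟨undoubleHom L e dV hdV hdV0 dW hdW hdW0 sD hproj, continuous_undoubleHom L e dV hdV hdV0 dW hdW hdW0 hc hproj, ?_, ?_⟩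
  · intro g
    exact proj_undouble L e dV hdV hdV0 dW hdW hdW0 hproj g
  · intro γ hγ
    exact undouble_mem_range_ratSection L e dV hdV hdV0 dW hdW hdW0 hproj hrat γ hγ

end S4

/-! ### Build-lane note (ops-buildfix G11b-3 recipe, LEDGER B13-1/B13-3, 2026-08-21)
`lean -o` (the hub build lane, never `lean`/the gate check) runs Lean 4.32's library-suggestion indexers
(`Lean.LibrarySuggestions.SymbolFrequency` / `SineQuaNon`, from their `exportEntriesFn`) over the statement of
every local theorem that is not a denied premise; on this family's statements (very large dependent binder
telescopes through the theta-kernel / dual-pair data) that fold runs for tens of minutes to hours and the build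
lane kills the job (incident G11b-3, run/shared/lean/ops/buildfix/G11b-3-DOSSIER.md). `isDeniedPremise` skips
`[implicit_reducible]` constants before any fold, and a reducibility status on a *theorem* is inert (Meta never
unfolds `thmInfo`; the kernel ignores the attribute), so the public theorems of this file are tagged
`[implicit_reducible]` purely to keep them out of that index. Only other effect: they are not offered by
`+suggestions` premise selectors. No statement or proof is changed; superseded if the operator lands a
deny-list form (`HarnessLib.PremiseIndex`). -/
set_option allowUnsafeReducibility true in
attribute [implicit_reducible]
  isUnit_det_gramA isUnit_gramA gramA_eq_map gramS_mul_one continuous_undoubleIdx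
  undoubleIdx_mem_adelicMpTheta_iff relabel_reindex_apply proj_undoubleIdx_apply coe_inlG coe_toSpD
  coe_toSp coe_toSpD_inlG continuous_inlG continuous_uD reindexW_conj_apply proj_uD exists_undouble
  proj_undouble omega_uD_tensorToSum testVec_zero testVec_ne_zero thetaDistLM_testVec_ne_zero
  undouble_unique undouble_mul undoubleHom_apply spSumEquiv_apply_inl proj_undouble_apply
  omega_undouble_apply continuous_undouble continuous_undoubleHom undouble_mem_adelicMpTheta
  undouble_mem_range_ratSection S4_undouble

end Literature.NumberTheory.GelbartRogawski1991.GRConstruction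

/- build-lane note, addendum (ops-buildfix B14-5, 2026-08-22): local theorem constants the `[implicit_reducible]` block above
cannot reach — auto-realized `*.congr_simp` lemmas, structure projections / `mk.inj` / `sizeOf_spec` — are still walked by the
`.olean` exporter's premise indexers (in-file census: FOLDED = 1, proxy 1.7e+11). A global `attribute` on a realized constant lands
on an async environment branch the exporter does not consult; this file-final, top-level `local` entry goes through the
synchronous scoped extension that `getReducibilityStatusCore` reads first and is never popped before export. It is not
exported and changes no statement or proof. -/
set_option allowUnsafeReducibility true in
attribute [local implicit_reducible]
  Literature.NumberTheory.GelbartRogawski1991.GRConstruction.undouble.congr_simp
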